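import Summits.Ventures.YMGap.Thresholds.PressureDerivative
import HarnessLib

/-!
# The free energy density is `C²` on the open strong-coupling window, `f'' =` the plaquette susceptibility
# (row type C-PRESS, part 2)

Cell `pub-ymgap`, seat ds-1 (gen 9). HONEST FRAMING: strong-coupling LATTICE statements for `SU(2)` Wilson lattice gauge
theory on `ℤ⁴`; `C²` regularity of the infinite-volume free energy density in the coupling — NOT analyticity; the window
`(0, 9/50)` (tree coupling; Wilson `β_W = 2β < 9/25`) is where the one-sided vertex-star Dobrushin bound closes, not a
transition; nothing about the continuum or the Clay problem. Kernel theorems only, 0 compute.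

Part 1 (`PressureDerivative.lean`) proved `f'(β) = -e(μ_β) = -Σ_{i<j} (2 - ⟨Re tr U_{p_ij}⟩_{μ_β})` at every `β ∈ [0, 9/50]`.
Here the energy density of the unique state is differentiated once more with g8's C-DIFF
(`CouplingResponse.su2_hasDerivAt_plaquette_9_25`: `d/dβ_W ⟨W_p⟩ = Σ_q Cov(W_p, W_q)`, `W = ½ Re tr`):

* `su2_hasDerivAt_freeEnergyDensity_wilson` — Wilson normalisation of part 1: `d/dβ_W f(β_W/2) = -Σ_{i<j} (1 - ⟨W_{p_ij}⟩)`;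
* `su2_hasDerivAt_plaquette_tree`, `su2_hasDerivAt_energyDensity` — `d/dβ ⟨Re tr U_p⟩_{μ_β} = 4 Σ_q Cov_{μ_β}(W_p, W_q)` and
  `d/dβ (-e(μ_β)) = Σ_{i<j} 4 Σ_q Cov_{μ_β}(W_{p_ij}, W_q)` on `(0, 9/50)`;
* ★★ `su2_hasDerivAt_deriv_freeEnergyDensity` — `f'` is differentiable at every `0 < β < 9/50` with
  `f''(β) = Σ_{i<j} 4 Σ_q Cov_{μ_β}(W_{p_ij}, W_q)`, the (absolutely convergent, `LinearResponseBound`) plaquette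
  susceptibility of the unique DLR state; `su2_deriv_deriv_freeEnergyDensity_eq` — the identity for EVERY `ν ∈ 𝒢(β)`;
* `su2_continuousOn_susceptibility` — `f''` is continuous on `[0, 9/50]` (`su2_continuousOn_responseSum`);
* ★★ `su2_contDiffOn_two_freeEnergyDensity : ContDiffOn ℝ 2 (freeEnergyDensity 4 (fundamentalRep (Fin 2))) (Ioo 0 (9/50))`
  — no first- or second-order transition in the strong-coupling window, as a kernel theorem about the thermodynamic
  potential (T42 / C-SUS said it about the state);
* `su2_susceptibility_nonneg` — `0 ≤ Σ_{i<j} 4 Σ_q Cov_ν(W_{p_ij}, W_q)`: the susceptibility is the second derivative of the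
  CONVEX `f` (`convexOn_freeEnergyDensity`, `ConvexOn.monotoneOn_deriv`).

References (mechanism): Friedli–Velenik 2017 Prop. 6.91; B. Simon, *The Statistical Mechanics of Lattice Gases* I (1993)
§II.1 (fluctuation–response). All inputs are tree theorems.
-/

noncomputable section

open MeasureTheory ProbabilityTheory Set Filter Topology
open scoped NNReal
open Literature.MathematicalPhysics.QuantumLattice (LGConfig ZdEdge ZdPlaquette fundamentalRep ymGibbsMeasures
  ymSpecification plaquetteObs plaquetteEdges freeEnergyDensity IsZdTranslationInvariant
  infiniteVolumeLimitPoints_nonempty_holds mem_ymGibbsMeasuresTI_of_mem_infiniteVolumeLimitPoints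
  continuous_fundamentalRep)
open Literature.MathematicalPhysics.QuantumFieldTheory hiding ZdEdge
open Summit.QuantumFields.YangMills.Theorems.FibreToTorus (energy_pressure_chord)

namespace Summit.Ventures.YMGap.PressureRegularity

section SU2C2

open Summit.Ventures.YMGap.CouplingResponse (su2_continuousOn_integral su2_continuousOn_responseSum
  su2_hasDerivAt_plaquette_9_25)

/-- Local shorthand: the planes `{(i, j) : i < j}` of `ℤ⁴`. -/
local notation3 (prettyPrint := false) "𝔓₄" => {q : Fin 4 × Fin 4 // q.1 < q.2}

/-- `SU(2)` is second countable (closed subgroup of `2 × 2` complex matrices). [folklore] -/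
private theorem secondCountable_su2' : SecondCountableTopology (Matrix.specialUnitaryGroup (Fin 2) ℂ) :=
  haveI : SecondCountableTopology (Matrix (Fin 2) (Fin 2) ℂ) :=
    inferInstanceAs (SecondCountableTopology (Fin 2 → Fin 2 → ℂ))
  Topology.IsEmbedding.subtypeVal.secondCountableTopology

/-- ★ **Wilson normalisation** (`β_W = 2β`, `W_p = ½ Re tr U_p`, the convention of T42): along any DLR selection
`β_W ↦ μ β_W ∈ 𝒢(2 (β_W/4))` on `[0, 9/25]`, `β_W ↦ f(β_W / 2)` has derivative `-Σ_{i<j} (1 - ⟨W_{p_ij}⟩_{μ β_W})` at every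
`0 < β_W < 9/25`. -/
theorem su2_hasDerivAt_freeEnergyDensity_wilson
    {μ : ℝ → Measure (LGConfig 4 (Matrix.specialUnitaryGroup (Fin 2) ℂ))}
    (hμ : ∀ βW ∈ Icc (0 : ℝ) (9 / 25), μ βW ∈ ymGibbsMeasures (d := 4) (fundamentalRep (Fin 2)) (2 * (βW / 4)))
    {βW : ℝ} (hb : βW ∈ Ioo (0 : ℝ) (9 / 25)) :
    HasDerivAt (fun t => freeEnergyDensity 4 (fundamentalRep (Fin 2)) (2 * (t / 4)))
      (-∑ q : 𝔓₄, ((1 : ℝ) - ∫ U, zdPlaquetteObs (fundamentalRep (Fin 2)) 0 q.1.1 q.1.2 U ∂(μ βW))) βW := by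
  -- the tree-coupling selection `β ↦ μ (2β)`
  have hν : ∀ β ∈ Icc (0 : ℝ) (9 / 50), μ (2 * β) ∈ ymGibbsMeasures (d := 4) (fundamentalRep (Fin 2)) β := by
    intro β hβ
    have h := hμ (2 * β) ⟨by linarith [hβ.1], by linarith [hβ.2]⟩
    rwa [show (2 : ℝ) * (2 * β / 4) = β by ring] at h
  have hderiv := su2_hasDerivAt_freeEnergyDensity hν (β := βW / 2) ⟨by linarith [hb.1], by linarith [hb.2]⟩
  rw [show (2 : ℝ) * (βW / 2) = βW by ring] at hderiv
  have hinner : HasDerivAt (fun t : ℝ => 2 * (t / 4)) (2 * (1 / 4)) βW :=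
    ((hasDerivAt_id βW).div_const 4).const_mul 2
  have hcomp := HasDerivAt.comp βW
    (h₂ := freeEnergyDensity 4 (fundamentalRep (Fin 2))) (h := fun t : ℝ => 2 * (t / 4))
    (by rw [show (2 : ℝ) * (βW / 4) = βW / 2 by ring]; exact hderiv) hinner
  refine hcomp.congr_deriv ?_
  have hscale : ∀ q : 𝔓₄, ∫ U, plaquetteObs (fundamentalRep (Fin 2)) 0 q.1.1 q.1.2 U ∂(μ βW) =
      2 * ∫ U, zdPlaquetteObs (fundamentalRep (Fin 2)) 0 q.1.1 q.1.2 U ∂(μ βW) := fun q => by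
    rw [← integral_const_mul]
    refine integral_congr_ae (ae_of_all _ fun U => ?_)
    rw [CouplingResponse.plaquetteObs_fundamentalRep_eq_mul_zdPlaquetteObs]
    norm_num
  simp only [hscale]
  have halg : ∀ a : 𝔓₄ → ℝ, (-∑ q : 𝔓₄, ((2 : ℝ) - 2 * a q)) * (2 * (1 / 4)) = -∑ q : 𝔓₄, ((1 : ℝ) - a q) := by
    intro a
    rw [neg_mul, Finset.sum_mul]
    congr 1
    exact Finset.sum_congr rfl fun q _ => by ring
  exact halg _

/-- **C-DIFF for one plaquette in the tree coupling**: along any DLR selection on `[0, 9/50]`,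
`t ↦ ⟨Re tr U_p⟩_{μ t}` has derivative `2 · 2 · Σ_q Cov_{μ β}(W_p, W_q)` at every `0 < β < 9/50` (g8's
`su2_hasDerivAt_plaquette_9_25` at `β_W = 2β`, times `Re tr = 2 W`). -/
theorem su2_hasDerivAt_plaquette_tree
    {μ : ℝ → Measure (LGConfig 4 (Matrix.specialUnitaryGroup (Fin 2) ℂ))}
    (hμ : ∀ β ∈ Icc (0 : ℝ) (9 / 50), μ β ∈ ymGibbsMeasures (d := 4) (fundamentalRep (Fin 2)) β)
    (p : ZdPlaquette 4) {β : ℝ} (hβ : β ∈ Ioo (0 : ℝ) (9 / 50)) :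
    HasDerivAt (fun t => ∫ U, plaquetteObs (fundamentalRep (Fin 2)) p.1 p.2.1.1 p.2.1.2 U ∂(μ t))
      (4 * ∑' q : ZdPlaquette 4, cov[zdPlaquetteObs (fundamentalRep (Fin 2)) p.1 p.2.1.1 p.2.1.2,
        zdPlaquetteObs (fundamentalRep (Fin 2)) q.1 q.2.1.1 q.2.1.2; μ β]) β := by
  -- the `β_W`-indexed selection `β_W ↦ μ (2 (β_W / 4))`
  have hμW : ∀ βW ∈ Icc (0 : ℝ) (9 / 25),
      μ (2 * (βW / 4)) ∈ ymGibbsMeasures (d := 4) (fundamentalRep (Fin 2)) (2 * (βW / 4)) :=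
    fun βW hβW => hμ _ ⟨by linarith [hβW.1], by linarith [hβW.2]⟩
  have hW := su2_hasDerivAt_plaquette_9_25 hμW p (βW := 2 * β) ⟨by linarith [hβ.1], by linarith [hβ.2]⟩
  rw [show (2 : ℝ) * (2 * β / 4) = β by ring] at hW
  have hinner : HasDerivAt (fun t : ℝ => 2 * t) 2 β := by
    simpa using (hasDerivAt_id β).const_mul (2 : ℝ)
  have hcomp := HasDerivAt.comp β
    (h₂ := fun s => ∫ U, zdPlaquetteObs (fundamentalRep (Fin 2)) p.1 p.2.1.1 p.2.1.2 U ∂(μ (2 * (s / 4))))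
    (h := fun t : ℝ => 2 * t) hW hinner
  have hfun : ((fun s => ∫ U, zdPlaquetteObs (fundamentalRep (Fin 2)) p.1 p.2.1.1 p.2.1.2 U ∂(μ (2 * (s / 4)))) ∘
      fun t : ℝ => 2 * t) = fun t => ∫ U, zdPlaquetteObs (fundamentalRep (Fin 2)) p.1 p.2.1.1 p.2.1.2 U ∂(μ t) := by
    funext t
    simp only [Function.comp_def]
    rw [show (2 : ℝ) * (2 * t / 4) = t by ring]
  rw [hfun] at hcomp
  have hscale : (fun t => ∫ U, plaquetteObs (fundamentalRep (Fin 2)) p.1 p.2.1.1 p.2.1.2 U ∂(μ t)) =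
      fun t => 2 * ∫ U, zdPlaquetteObs (fundamentalRep (Fin 2)) p.1 p.2.1.1 p.2.1.2 U ∂(μ t) := by
    funext t
    rw [← integral_const_mul]
    refine integral_congr_ae (ae_of_all _ fun U => ?_)
    rw [CouplingResponse.plaquetteObs_fundamentalRep_eq_mul_zdPlaquetteObs]
    norm_num
  rw [hscale]
  refine (hcomp.const_mul 2).congr_deriv ?_
  ring

/-- ★ **The energy density of the unique state is differentiable in the coupling**: along any DLR selection on
`[0, 9/50]`, `t ↦ -e(μ_t) = -Σ_{i<j} (2 - ⟨Re tr U_{p_ij}⟩_{μ t})` has derivative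
`Σ_{i<j} 4 Σ_q Cov_{μ β}(W_{p_ij}, W_q)` (the plaquette susceptibility) at every `0 < β < 9/50`. -/
theorem su2_hasDerivAt_energyDensity
    {μ : ℝ → Measure (LGConfig 4 (Matrix.specialUnitaryGroup (Fin 2) ℂ))}
    (hμ : ∀ β ∈ Icc (0 : ℝ) (9 / 50), μ β ∈ ymGibbsMeasures (d := 4) (fundamentalRep (Fin 2)) β)
    {β : ℝ} (hβ : β ∈ Ioo (0 : ℝ) (9 / 50)) :
    HasDerivAt (fun t => -∑ q : 𝔓₄, ((2 : ℝ) - ∫ U, plaquetteObs (fundamentalRep (Fin 2)) 0 q.1.1 q.1.2 U ∂(μ t)))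
      (∑ q : 𝔓₄, 4 * ∑' r : ZdPlaquette 4, cov[zdPlaquetteObs (fundamentalRep (Fin 2)) 0 q.1.1 q.1.2,
        zdPlaquetteObs (fundamentalRep (Fin 2)) r.1 r.2.1.1 r.2.1.2; μ β]) β := by
  have h := HasDerivAt.fun_sum (u := (Finset.univ : Finset 𝔓₄)) fun q _ =>
    ((hasDerivAt_const β (2 : ℝ)).sub
      (su2_hasDerivAt_plaquette_tree hμ ((0 : Literature.Probability.LatticeModels.Site 4), q) hβ))
  refine h.fun_neg.congr_deriv ?_
  rw [← Finset.sum_neg_distrib]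
  exact Finset.sum_congr rfl fun q _ => by ring

/-- ★★ **`SU(2)`, `d = 4`: the free energy density is TWICE differentiable at every `0 < β < 9/50`, with
`f''(β) = Σ_{i<j} 4 Σ_q Cov_{μ β}(W_{p_ij}, W_q)` — the plaquette susceptibility of the unique DLR state.** -/
theorem su2_hasDerivAt_deriv_freeEnergyDensity
    {μ : ℝ → Measure (LGConfig 4 (Matrix.specialUnitaryGroup (Fin 2) ℂ))}
    (hμ : ∀ β ∈ Icc (0 : ℝ) (9 / 50), μ β ∈ ymGibbsMeasures (d := 4) (fundamentalRep (Fin 2)) β)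
    {β : ℝ} (hβ : β ∈ Ioo (0 : ℝ) (9 / 50)) :
    HasDerivAt (deriv (freeEnergyDensity 4 (fundamentalRep (Fin 2))))
      (∑ q : 𝔓₄, 4 * ∑' r : ZdPlaquette 4, cov[zdPlaquetteObs (fundamentalRep (Fin 2)) 0 q.1.1 q.1.2,
        zdPlaquetteObs (fundamentalRep (Fin 2)) r.1 r.2.1.1 r.2.1.2; μ β]) β := by
  refine (su2_hasDerivAt_energyDensity hμ hβ).congr_of_eventuallyEq ?_
  filter_upwards [Ioo_mem_nhds hβ.1 hβ.2] with t ht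
  exact (su2_hasDerivAt_freeEnergyDensity hμ ht).deriv

/-- **The second thermodynamic identity at EVERY coupling of the open window**: `f''(β) = Σ_{i<j} 4 Σ_q Cov_ν(W_{p_ij}, W_q)`
for every DLR state `ν ∈ 𝒢(β)`, `0 < β < 9/50`. -/
theorem su2_deriv_deriv_freeEnergyDensity_eq {β : ℝ} (hβ : β ∈ Ioo (0 : ℝ) (9 / 50))
    {ν : Measure (LGConfig 4 (Matrix.specialUnitaryGroup (Fin 2) ℂ))}
    (hν : ν ∈ ymGibbsMeasures (d := 4) (fundamentalRep (Fin 2)) β) :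
    deriv (deriv (freeEnergyDensity 4 (fundamentalRep (Fin 2)))) β =
      ∑ q : 𝔓₄, 4 * ∑' r : ZdPlaquette 4, cov[zdPlaquetteObs (fundamentalRep (Fin 2)) 0 q.1.1 q.1.2,
        zdPlaquetteObs (fundamentalRep (Fin 2)) r.1 r.2.1.1 r.2.1.2; ν] := by
  classical
  obtain ⟨μ, hμ⟩ := CouplingResponse.exists_dlrSelection
  set μ' : ℝ → Measure (LGConfig 4 (Matrix.specialUnitaryGroup (Fin 2) ℂ)) :=
    fun t => if t = β then ν else μ (2 * t) with hμ'
  have hμ'sel : ∀ t ∈ Icc (0 : ℝ) (9 / 50), μ' t ∈ ymGibbsMeasures (d := 4) (fundamentalRep (Fin 2)) t := by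
    intro t _
    by_cases ht : t = β
    · simp only [hμ', ht, if_true]; exact hν
    · simp only [hμ', ht, if_false]
      have h := hμ (2 * t)
      rwa [show (2 : ℝ) * (2 * t / 4) = t by ring] at h
  have h := (su2_hasDerivAt_deriv_freeEnergyDensity hμ'sel hβ).deriv
  simpa [hμ'] using h

/-- ★ **Selection-free form of part 1**: `HasDerivAt f (-Σ_{i<j} (2 - ⟨Re tr U_{p_ij}⟩_ν)) β` for EVERY DLR state
`ν ∈ 𝒢(β)`, `0 < β < 9/50` (splice `ν` into any DLR selection; the state is unique anyway). -/
theorem su2_hasDerivAt_freeEnergyDensity_of_mem {β : ℝ} (hβ : β ∈ Ioo (0 : ℝ) (9 / 50))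
    {ν : Measure (LGConfig 4 (Matrix.specialUnitaryGroup (Fin 2) ℂ))}
    (hν : ν ∈ ymGibbsMeasures (d := 4) (fundamentalRep (Fin 2)) β) :
    HasDerivAt (freeEnergyDensity 4 (fundamentalRep (Fin 2)))
      (-∑ q : 𝔓₄, ((2 : ℝ) - ∫ U, plaquetteObs (fundamentalRep (Fin 2)) 0 q.1.1 q.1.2 U ∂ν)) β := by
  classical
  obtain ⟨μ, hμ⟩ := CouplingResponse.exists_dlrSelection
  have hsel : ∀ t ∈ Icc (0 : ℝ) (9 / 50),
      (fun t => if t = β then ν else μ (2 * t)) t ∈ ymGibbsMeasures (d := 4) (fundamentalRep (Fin 2)) t := by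
    intro t _
    by_cases ht : t = β
    · simp only [ht, if_true]; exact hν
    · simp only [ht, if_false]
      have h := hμ (2 * t)
      rwa [show (2 : ℝ) * (2 * t / 4) = t by ring] at h
  simpa using su2_hasDerivAt_freeEnergyDensity hsel hβ

/-- ★★ **Selection-free second derivative**: `HasDerivAt f' (Σ_{i<j} 4 Σ_q Cov_ν(W_{p_ij}, W_q)) β` for EVERY DLR state
`ν ∈ 𝒢(β)`, `0 < β < 9/50`. -/
theorem su2_hasDerivAt_deriv_freeEnergyDensity_of_mem {β : ℝ} (hβ : β ∈ Ioo (0 : ℝ) (9 / 50))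
    {ν : Measure (LGConfig 4 (Matrix.specialUnitaryGroup (Fin 2) ℂ))}
    (hν : ν ∈ ymGibbsMeasures (d := 4) (fundamentalRep (Fin 2)) β) :
    HasDerivAt (deriv (freeEnergyDensity 4 (fundamentalRep (Fin 2))))
      (∑ q : 𝔓₄, 4 * ∑' r : ZdPlaquette 4, cov[zdPlaquetteObs (fundamentalRep (Fin 2)) 0 q.1.1 q.1.2,
        zdPlaquetteObs (fundamentalRep (Fin 2)) r.1 r.2.1.1 r.2.1.2; ν]) β := by
  classical
  obtain ⟨μ, hμ⟩ := CouplingResponse.exists_dlrSelection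
  have hsel : ∀ t ∈ Icc (0 : ℝ) (9 / 50),
      (fun t => if t = β then ν else μ (2 * t)) t ∈ ymGibbsMeasures (d := 4) (fundamentalRep (Fin 2)) t := by
    intro t _
    by_cases ht : t = β
    · simp only [ht, if_true]; exact hν
    · simp only [ht, if_false]
      have h := hμ (2 * t)
      rwa [show (2 : ℝ) * (2 * t / 4) = t by ring] at h
  simpa using su2_hasDerivAt_deriv_freeEnergyDensity hsel hβ

/-- **The susceptibility is continuous on the closed window** (tree coupling): along any DLR selection on `[0, 9/50]`,
`β ↦ Σ_{i<j} 4 Σ_q Cov_{μ β}(W_{p_ij}, W_q)` is continuous on `[0, 9/50]` (g8's `su2_continuousOn_responseSum`). -/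
theorem su2_continuousOn_susceptibility
    {μ : ℝ → Measure (LGConfig 4 (Matrix.specialUnitaryGroup (Fin 2) ℂ))}
    (hμ : ∀ β ∈ Icc (0 : ℝ) (9 / 50), μ β ∈ ymGibbsMeasures (d := 4) (fundamentalRep (Fin 2)) β) :
    ContinuousOn (fun β => ∑ q : 𝔓₄, 4 * ∑' r : ZdPlaquette 4,
      cov[zdPlaquetteObs (fundamentalRep (Fin 2)) 0 q.1.1 q.1.2,
        zdPlaquetteObs (fundamentalRep (Fin 2)) r.1 r.2.1.1 r.2.1.2; μ β]) (Icc (0 : ℝ) (9 / 50)) := by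
  have hμW : ∀ βW ∈ Icc (0 : ℝ) (9 / 25),
      μ (2 * (βW / 4)) ∈ ymGibbsMeasures (d := 4) (fundamentalRep (Fin 2)) (2 * (βW / 4)) :=
    fun βW hβW => hμ _ ⟨by linarith [hβW.1], by linarith [hβW.2]⟩
  refine continuousOn_finsetSum _ fun q _ => continuousOn_const.mul ?_
  have hW := su2_continuousOn_responseSum le_rfl hμW
    (isLipschitzCylinder_zdPlaquetteObs (N := 2) (0 : Literature.Probability.LatticeModels.Site 4) q.2)
    (x₀ := 0) (D := 1) (fun e he => by simpa using norm_fst_sub_le_of_mem_plaquetteEdges he)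
  have hcomp : ContinuousOn ((fun βW => ∑' r : ZdPlaquette 4,
      cov[zdPlaquetteObs (fundamentalRep (Fin 2)) 0 q.1.1 q.1.2,
        zdPlaquetteObs (fundamentalRep (Fin 2)) r.1 r.2.1.1 r.2.1.2; μ (2 * (βW / 4))]) ∘ fun β : ℝ => 2 * β)
      (Icc (0 : ℝ) (9 / 50)) :=
    hW.comp (continuous_const.mul continuous_id).continuousOn
      fun β hβ => ⟨by linarith [hβ.1], by linarith [hβ.2]⟩
  refine hcomp.congr fun β _ => ?_
  simp only [Function.comp_def]
  rw [show (2 : ℝ) * (2 * β / 4) = β by ring]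

/-- ★★ **`f ∈ C²` on the open window**: `ContDiffOn ℝ 2 (freeEnergyDensity 4 ρ_{SU(2)}) (0, 9/50)` — NO FIRST- OR
SECOND-ORDER TRANSITION on the strong-coupling window, as a kernel theorem about the thermodynamic potential. -/
theorem su2_contDiffOn_two_freeEnergyDensity :
    ContDiffOn ℝ 2 (freeEnergyDensity 4 (fundamentalRep (Fin 2))) (Ioo (0 : ℝ) (9 / 50)) := by
  obtain ⟨μ, hμ⟩ := CouplingResponse.exists_dlrSelection
  have hμsel : ∀ t ∈ Icc (0 : ℝ) (9 / 50), μ (2 * t) ∈ ymGibbsMeasures (d := 4) (fundamentalRep (Fin 2)) t := by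
    intro t _
    have h := hμ (2 * t)
    rwa [show (2 : ℝ) * (2 * t / 4) = t by ring] at h
  rw [show (2 : WithTop ℕ∞) = 1 + 1 from rfl, contDiffOn_succ_iff_deriv_of_isOpen isOpen_Ioo]
  refine ⟨su2_differentiableOn_freeEnergyDensity, fun h => absurd h (by simp), ?_⟩
  exact CouplingResponse.contDiffOn_one_of_hasDerivAt
    (fun t ht => su2_hasDerivAt_deriv_freeEnergyDensity hμsel ht) (su2_continuousOn_susceptibility hμsel)

/-- **The susceptibility is non-negative**: `0 ≤ Σ_{i<j} 4 Σ_q Cov_ν(W_{p_ij}, W_q)` for every DLR state at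
`0 < β < 9/50` — it is the second derivative of the CONVEX free energy density (`convexOn_freeEnergyDensity`). -/
theorem su2_susceptibility_nonneg {β : ℝ} (hβ : β ∈ Ioo (0 : ℝ) (9 / 50))
    {ν : Measure (LGConfig 4 (Matrix.specialUnitaryGroup (Fin 2) ℂ))}
    (hν : ν ∈ ymGibbsMeasures (d := 4) (fundamentalRep (Fin 2)) β) :
    0 ≤ ∑ q : 𝔓₄, 4 * ∑' r : ZdPlaquette 4, cov[zdPlaquetteObs (fundamentalRep (Fin 2)) 0 q.1.1 q.1.2,
        zdPlaquetteObs (fundamentalRep (Fin 2)) r.1 r.2.1.1 r.2.1.2; ν] := by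
  classical
  haveI := secondCountable_su2'
  obtain ⟨μ, hμ⟩ := CouplingResponse.exists_dlrSelection
  set μ' : ℝ → Measure (LGConfig 4 (Matrix.specialUnitaryGroup (Fin 2) ℂ)) :=
    fun t => if t = β then ν else μ (2 * t) with hμ'
  have hμ'sel : ∀ t ∈ Icc (0 : ℝ) (9 / 50), μ' t ∈ ymGibbsMeasures (d := 4) (fundamentalRep (Fin 2)) t := by
    intro t _
    by_cases ht : t = β
    · simp only [hμ', ht, if_true]; exact hν
    · simp only [hμ', ht, if_false]
      have h := hμ (2 * t)
      rwa [show (2 : ℝ) * (2 * t / 4) = t by ring] at h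
  -- `deriv f` is monotone on the open window (convexity), hence its derivative there is `≥ 0`
  have hconv := convexOn_freeEnergyDensity (d := 4) (fundamentalRep (Fin 2)) (continuous_fundamentalRep _)
  have hmono : MonotoneOn (deriv (freeEnergyDensity 4 (fundamentalRep (Fin 2)))) (Ioo (0 : ℝ) (9 / 50)) :=
    (hconv.subset (subset_univ _) (convex_Ioo _ _)).monotoneOn_deriv fun x hx =>
      (su2_differentiableOn_freeEnergyDensity x hx).differentiableAt (Ioo_mem_nhds hx.1 hx.2)
  have hd := su2_hasDerivAt_deriv_freeEnergyDensity hμ'sel hβ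
  have hμ'β : μ' β = ν := by simp [hμ']
  rw [hμ'β] at hd
  have h1 : 0 ≤ derivWithin (deriv (freeEnergyDensity 4 (fundamentalRep (Fin 2)))) (Ioo (0 : ℝ) (9 / 50)) β :=
    hmono.derivWithin_nonneg
  rwa [derivWithin_of_mem_nhds (Ioo_mem_nhds hβ.1 hβ.2), hd.deriv] at h1

end SU2C2

end Summit.Ventures.YMGap.PressureRegularity

end
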